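import Summits.HodgeConjecture.CorCM.QuadraticCMFamiliesSeparating
import Literature.NumberTheory.ComplexMultiplication.ImaginaryQuadraticFieldGenerators
import HarnessLib

/-!
# Families of CM types of PAIRWISE NON-ISOMORPHIC imaginary quadratic fields are separating — and conversely

COR-CM (cell `pub-hodgecm2`, seat `b16` gen 35), count-neutral, theorems only (no definition, no named fact).
Closes the HONEST-SCOPE gap recorded in `QuadraticCMFamiliesSeparating` («"`K_i ≄ K_j`" in abstract form is not
treated»; lit-deligne-3 g4 DELIVERABLE §4, residual ASK-4′): there the separation of a family of CM types of
imaginary quadratic fields `K_i` is derived from GENERATORS `a_i ∈ K_i`, `a_i² = -d_i`, `d_i d_j` not a square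
(`isSeparatingFamily_of_sq_eq_neg`).  Every imaginary quadratic field has such a generator with `d_i` squarefree
(`ImaginaryQuadratic.exists_sq_eq_neg_squarefree`, normal form `ℚ(√-d)`), and for squarefree `d_i, d_j` the product
`d_i d_j` is a square only if `d_i = d_j`, in which case `K_i ≅ ℚ[X]/(X² + d_i) ≅ K_j`
(`ImaginaryQuadratic.not_isSquare_mul_of_isEmpty_ringEquiv`).  Hence:

* **`isSeparatingFamily_of_pairwise_isEmpty_ringEquiv`** — if the degree-`2` CM fields `K_i` are PAIRWISE
  NON-ISOMORPHIC (`IsEmpty (K i ≃+* K j)` for `i ≠ j`), every family `Φ = (Φ_i)` of CM types on them is separating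
  (Kubota); conversely **`isEmpty_ringEquiv_of_isSeparatingFamily`** — a separating family has pairwise
  non-isomorphic fields (an isomorphism `e : K_i ≃ K_j`, composed if necessary with complex conjugation of `K_i`,
  transports `Φ_i` to `Φ_j`, contradicting `IsSeparatingFamily.eq_of_forall_mem_iff_comp_mem`); together
  **`isSeparatingFamily_iff_pairwise_isEmpty_ringEquiv`**: for imaginary quadratic fields,
  SEPARATING ⟺ FIELDS PAIRWISE NON-ISOMORPHIC (⟺ NONDEGENERATE, `isNondegenerateFamily_iff_…_of_finrank_eq_two`);
* **`isNondegenerateFamily_of_pairwise_isEmpty_ringEquiv`** — such a family is nondegenerate: Deligne's rank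
  `cmFamilyRank Φ = |I| + 1`, i.e. `rk X*(MT(∏_i E_i)) = n + 1` for CM elliptic curves `E_1, …, E_n` with pairwise
  non-isomorphic CM fields — the CM case of Moonen–Zarhin Cor. (3.9) (Imai) «Let `X₁, …, X_n` be elliptic curves
  over `ℂ`, no two of which are isogenous … Then `Hg(X) = Hg(X₁) × ⋯ × Hg(X_n)`» in rank form (for CM curves
  "non-isogenous" = "non-isomorphic CM fields");
* `hodgeClassSpan_prod_eq_divisorClassesSpan_of_pairwise_isEmpty_ringEquiv`, `hodgeConjectureFor_prod_of_pairwise_…`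
  — `B = D` and the Hodge conjecture on every product `⨁_{j<N} E_{π j}` of realisations, BY NAME through
  `QuadraticCMFamiliesHodge` (a second, CM-type-combinatorial proof; the Hodge-theoretic proof for ALL products of
  elliptic curves is the tree's `HodgeTheory/EllipticCurvesProductsHodgeConjecture`).

Sources: Moonen–Zarhin, Math. Ann. 315 (1999), Cor. (3.9); Kubota 1965 §2; Shimura 1998 §18.2 (1) (normal form of
a CM field).  Not a step of `HC_CM`/`HC_AV`; wording of record untouched.
-/

set_option autoImplicit false

noncomputable section

open CategoryTheory CategoryTheory.Limits NumberField
open scoped BigOperators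

namespace Summit.HodgeConjecture.CorCM

open Literature.NumberTheory.ComplexMultiplication
open Literature.AlgebraicGeometry.Motives (AbelianVariety CMType)
open Literature.AlgebraicGeometry.HodgeTheory
open Literature.AlgebraicGeometry.ComplexMultiplication (IsCMTypeRealisation)
open Literature.AlgebraicGeometry.VanGeemen1994 (hodgeClassSpan)
open Literature.AlgebraicGeometry.Pohlmann1968
open Literature.Barriers.HodgeConjecture (divisorClassesSpan)

section Family

variable {I : Type} {K : I → Type} [∀ i, Field (K i)] [∀ i, NumberField (K i)] [∀ i, IsCMField (K i)]

/-- **Pairwise non-isomorphic imaginary quadratic fields carry only separating families of CM types** (Kubota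
separation for `∏_i E_i`, `E_i` CM elliptic curves with pairwise non-isomorphic CM fields): choose `a_i² = -d_i`,
`d_i` squarefree; `K_i ≄ K_j` makes `d_i d_j` a non-square, and `isSeparatingFamily_of_sq_eq_neg` applies.
[cite: Kubota1965, §2 (p. 115)] [cite: MoonenZarhin1999LowDim, Cor. (3.9)] -/
theorem isSeparatingFamily_of_pairwise_isEmpty_ringEquiv (hK : ∀ i, Module.finrank ℚ (K i) = 2)
    (hne : ∀ i j, i ≠ j → IsEmpty (K i ≃+* K j)) (Φ : ∀ i, CMType (K i)) : CMAlgebra.IsSeparatingFamily Φ := by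
  choose a d hd ha using fun i => ImaginaryQuadratic.exists_sq_eq_neg_squarefree (K := K i) (hK i)
  exact isSeparatingFamily_of_sq_eq_neg hK ha (fun i j hij =>
    ImaginaryQuadratic.not_isSquare_mul_of_isEmpty_ringEquiv (hK i) (hK j) (hd i) (hd j) (ha i) (ha j)
      (hne i j hij)) Φ

/-- Transport of a CM type of a degree-`2` field along a field isomorphism `f : K_i ≃ K_j` is decided on ONE
embedding `t` of `K_j`: if `t ∈ Φ_j ↔ t ∘ f ∈ Φ_i` then the same holds for every embedding (the other one is `t̄`,
and both types are stable under `s ↦ s̄`-complementation). [cite: Kubota1965, §2 (p. 115)] -/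
theorem forall_mem_iff_comp_mem_of_finrank_eq_two (hK : ∀ i, Module.finrank ℚ (K i) = 2) (Φ : ∀ i, CMType (K i))
    {i j : I} (f : K i ≃+* K j) (t : K j →+* ℂ) (hf : t ∈ (Φ j).1 ↔ t.comp f.toRingHom ∈ (Φ i).1)
    (u : K j →+* ℂ) : u ∈ (Φ j).1 ↔ u.comp f.toRingHom ∈ (Φ i).1 := by
  rcases QuadGen.eq_or_eq_conj_smul (Φ j) (hK j) t u with rfl | rfl
  · exact hf
  · have h2 : ((starRingAut : ℂ ≃+* ℂ) • t).comp f.toRingHom = (starRingAut : ℂ ≃+* ℂ) • (t.comp f.toRingHom) :=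
      rfl
    rw [(isCMTypeWith_conj (Φ j)).rho_smul_mem_iff, h2, (isCMTypeWith_conj (Φ i)).rho_smul_mem_iff, not_iff_not]
    exact hf

/-- **A separating family of CM types of imaginary quadratic fields has pairwise non-isomorphic fields**: an
isomorphism `e : K_i ≃ K_j` (`i ≠ j`), composed if necessary with the complex conjugation of the CM field `K_i`,
satisfies `Φ_j = {u | u ∘ e ∈ Φ_i}`, which `IsSeparatingFamily.eq_of_forall_mem_iff_comp_mem` forbids ("the `A_i`
pairwise non-isogenous"). [cite: Kubota1965, §2 (p. 115)] [cite: Gordon1999HodgeAVSurvey, 7.4] -/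
theorem isEmpty_ringEquiv_of_isSeparatingFamily (hK : ∀ i, Module.finrank ℚ (K i) = 2) {Φ : ∀ i, CMType (K i)}
    (hΦ : CMAlgebra.IsSeparatingFamily Φ) {i j : I} (hij : i ≠ j) : IsEmpty (K i ≃+* K j) := by
  refine ⟨fun e => hij ?_⟩
  obtain ⟨t⟩ := (inferInstance : Nonempty (K j →+* ℂ))
  by_cases h : (t ∈ (Φ j).1 ↔ t.comp e.toRingHom ∈ (Φ i).1)
  · exact hΦ.eq_of_forall_mem_iff_comp_mem e (forall_mem_iff_comp_mem_of_finrank_eq_two hK Φ e t h)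
  · let f : K i ≃+* K j := (IsCMField.complexConj (K i)).toRingEquiv.trans e
    have hf : t.comp f.toRingHom = (starRingAut : ℂ ≃+* ℂ) • (t.comp e.toRingHom) := by
      rw [conj_smul_eq_conjugate]
      exact RingHom.ext fun x => IsCMField.complexEmbedding_complexConj (K i) (t.comp e.toRingHom) x
    refine hΦ.eq_of_forall_mem_iff_comp_mem f (forall_mem_iff_comp_mem_of_finrank_eq_two hK Φ f t ?_)
    rw [hf, (isCMTypeWith_conj (Φ i)).rho_smul_mem_iff]
    tauto

/-- **For imaginary quadratic fields: SEPARATING ⟺ FIELDS PAIRWISE NON-ISOMORPHIC** (for CM elliptic curves: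
"pairwise non-isogenous" ⟺ "pairwise non-isomorphic CM fields"). [cite: Kubota1965, §2 (p. 115)] [cite: MoonenZarhin1999LowDim, Cor. (3.9)] -/
theorem isSeparatingFamily_iff_pairwise_isEmpty_ringEquiv (hK : ∀ i, Module.finrank ℚ (K i) = 2)
    (Φ : ∀ i, CMType (K i)) : CMAlgebra.IsSeparatingFamily Φ ↔ ∀ i j, i ≠ j → IsEmpty (K i ≃+* K j) :=
  ⟨fun h _ _ hij => isEmpty_ringEquiv_of_isSeparatingFamily hK h hij,
    fun h => isSeparatingFamily_of_pairwise_isEmpty_ringEquiv hK h Φ⟩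

variable [Fintype I] [Nonempty I]

/-- **Nondegeneracy (Deligne's rank `= |I| + 1`) for CM types of pairwise non-isomorphic imaginary quadratic fields**:
`rk X*(MT(E_1 × ⋯ × E_n)) = n + 1` for CM elliptic curves with pairwise non-isomorphic CM fields — the CM case of
Imai / Moonen–Zarhin Cor. (3.9) «no two of which are isogenous … `Hg(X) = Hg(X₁) × ⋯ × Hg(X_n)`» in rank form.
[cite: MoonenZarhin1999LowDim, Cor. (3.9)] [cite: Deligne1982HodgeCycles, I Ex. 3.7 (c) (p. 26)] -/
theorem isNondegenerateFamily_of_pairwise_isEmpty_ringEquiv (hK : ∀ i, Module.finrank ℚ (K i) = 2)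
    (hne : ∀ i j, i ≠ j → IsEmpty (K i ≃+* K j)) (Φ : ∀ i, CMType (K i)) : CMAlgebra.IsNondegenerateFamily Φ :=
  isNondegenerateFamily_of_finrank_eq_two hK (isSeparatingFamily_of_pairwise_isEmpty_ringEquiv hK hne Φ)

/-- **For imaginary quadratic fields: NONDEGENERATE family ⟺ fields pairwise non-isomorphic.**
[cite: MoonenZarhin1999LowDim, Cor. (3.9)] [cite: Kubota1965, §2 (p. 115)] -/
theorem isNondegenerateFamily_iff_pairwise_isEmpty_ringEquiv (hK : ∀ i, Module.finrank ℚ (K i) = 2)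
    (Φ : ∀ i, CMType (K i)) : CMAlgebra.IsNondegenerateFamily Φ ↔ ∀ i j, i ≠ j → IsEmpty (K i ≃+* K j) := by
  rw [isNondegenerateFamily_iff_isSeparatingFamily_of_finrank_eq_two hK, isSeparatingFamily_iff_pairwise_isEmpty_ringEquiv hK]

variable {Φ : ∀ i, CMType (K i)} {A : I → AbelianVariety ℂ} {ι : ∀ i, 𝓞 (K i) →+* End (A i)}
  {θ : ∀ i, K i →+* Module.End ℂ (complexBetti (A i).X 1)}

/-- **`Bᵐ ⊗ ℂ = Dᵐ ⊗ ℂ` on every product `⨁_{j<N} E_{π j}` of CM elliptic curves whose CM fields are pairwise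
non-isomorphic imaginary quadratic fields** (every realisation of any CM types of such fields; CM case of Moonen–Zarhin
Cor. (3.9) «every product of elliptic curves satisfies condition (D)», via Deligne's rank). [cite: MoonenZarhin1999LowDim, Cor. (3.9)] -/
theorem hodgeClassSpan_prod_eq_divisorClassesSpan_of_pairwise_isEmpty_ringEquiv
    (hK : ∀ i, Module.finrank ℚ (K i) = 2) (hne : ∀ i j, i ≠ j → IsEmpty (K i ≃+* K j))
    (hA : ∀ i, IsCMTypeRealisation (Φ i) (A i) (ι i) (θ i)) {N : ℕ} (π : Fin N → I) (m : ℕ) :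
    hodgeClassSpan (⨁ fun j : Fin N => A (π j)).dim (⨁ fun j : Fin N => A (π j)).X m =
      divisorClassesSpan (⨁ fun j : Fin N => A (π j)).X (⨁ fun j : Fin N => A (π j)).dim m :=
  (isNondegenerateFamily_of_pairwise_isEmpty_ringEquiv hK hne Φ).hodgeClassSpan_prod_eq_divisorClassesSpan hA π m

/-- **The Hodge conjecture for every product `⨁_{j<N} E_{π j}` (every `∏_i E_i^{k_i}`) of CM elliptic curves with
CM by PAIRWISE NON-ISOMORPHIC imaginary quadratic fields**, UNCONDITIONAL, through the CM-type combinatorics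
(nondegenerate ⟹ Hodge classes are polynomials in divisor classes ⟹ algebraic by Lefschetz (1,1)); a second proof
next to the Hodge-theoretic `HodgeTheory/EllipticCurvesProductsHodgeConjecture` (all products of elliptic curves).
[cite: MoonenZarhin1999LowDim, Cor. (3.9)] [cite: Gordon1999HodgeAVSurvey, §3 Theorem and 10.10] -/
theorem hodgeConjectureFor_prod_of_pairwise_isEmpty_ringEquiv (hK : ∀ i, Module.finrank ℚ (K i) = 2)
    (hne : ∀ i j, i ≠ j → IsEmpty (K i ≃+* K j)) (hA : ∀ i, IsCMTypeRealisation (Φ i) (A i) (ι i) (θ i))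
    {N : ℕ} (π : Fin N → I) : HodgeConjectureFor (⨁ fun j : Fin N => A (π j)).dim (⨁ fun j : Fin N => A (π j)).X :=
  (isNondegenerateFamily_of_pairwise_isEmpty_ringEquiv hK hne Φ).hodgeConjectureFor_prod hA π

end Family

end Summit.HodgeConjecture.CorCM

end
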